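import Summits.QuantumFields.BalabanUV.Beta.D1BFx.MomentTransferPeriodicSum
import Literature.MathematicalPhysics.QuantumFieldTheory.Balaban1983to89.Beta.AffineAveraging

/-!
# `BalabanUV.Beta.D1BFx.BlockSumTranspose` — road «BF-x» for binder row D1, slot (K), census group G_Λ, two [folklore] PLUMBING BRICKS of the Λ dictionary
# (an3-g53 `LAMBDA-DICTIONARY.v1.md` §4 (S-BLOCK), (S-TRANSP)): the END's base-point index `resSite` ↔ `LamCoeffMoments`' `box ∕ toSite`, and the BASE∕RUNNING-SITE
# TRANSPOSITION of a block-summed, evenly weighted lattice sum of a jointly block-periodic two-point function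

HONEST DEPENDENCY (cell records, verbatim): «continuum YM on T⁴ ⇐ BetaPertH ∧ nine spine estimates (0/9 proved); BetaPertH ⇐ (D1) ∧ (D4) ∧
CAP+tail; G-an2-4 gates asym, D1 and NE2/3/4.»  HONEST FRAMING (cell contract, verbatim): «discharging `BetaPertH` makes Bałaban's UV stability
UNCONDITIONAL — a real constructive-QFT result; it is NOT the continuum limit and NOT the Clay problem.»  THIS MODULE DISCHARGES NOTHING of (K),
of D1 or of the wall: [folklore] finite∕`tsum` bookkeeping (`MomentTransferPeriodicSum.sum_resSite_sub_eq`, `Summable.tsum_finsetSum`, `Equiv.tsum_eq` BY NAME).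
No definition, no `def … : Prop`, nothing cited, no wall binder instantiated, 0 sorry.  NOT D1, NOT BetaPertH, NOT continuum, NOT Clay.

ABSOLUTE RULE (cell charter, verbatim): «No internally-minted statement may enter as a cited fact. Every hypothesis is either kernel-proved in this
package or a verbatim quotation of a PUBLISHED theorem with page reference. The manuscript(s) under audit are NOT citable for their own disputed
steps — they are the thing under adjudication; programme-internal (2001/route/tribunal) claims are never citable.»

CONTENT ([folklore]): §1 **`sum_box_toSite_eq_sum_resSite`** (S-BLOCK); §2 **`sum_resSite_tsum_transpose`** (S-TRANSP).  Unit `b2b-balaban-beta-d1-p2` (road owner, gen 9).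
-/

noncomputable section

open Finset Filter Topology
open scoped BigOperators
open Literature.MathematicalPhysics.QuantumFieldTheory.Balaban1983to89
open Literature.MathematicalPhysics.QuantumFieldTheory.Balaban1983to89.Beta
open DressedMomentNormalisation (resSite)
open AffineAveraging (box toSite)
open Summit.QuantumFields.BalabanUV.Beta.D1BFx.MomentTransferPeriodicSum (sum_resSite_sub_eq)

namespace Summit.QuantumFields.BalabanUV.Beta.D1BFx.BlockSumTranspose

variable {d N : ℕ}

/-! ## §1 (S-BLOCK): `box ∕ toSite` sums are `resSite` sums -/

/-- [folklore] **(S-BLOCK)**: `Σ_{b ∈ box d N} F (toSite b) = Σ_{r : Fin d → Fin N} F (resSite r)` — the bijection `r ↦ (i ↦ (r i : ℕ))`. -/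
theorem sum_box_toSite_eq_sum_resSite [NeZero N] (F : (Fin d → ℤ) → ℝ) :
    ∑ b ∈ box d N, F (toSite b) = ∑ r : Fin d → Fin N, F (resSite r) := by
  classical
  symm
  refine Finset.sum_nbij' (fun r i => (r i : ℕ)) (fun b i => ⟨b i % N, Nat.mod_lt _ (NeZero.pos N)⟩) ?_ ?_ ?_ ?_ ?_
  · intro r _
    simp only [AffineAveraging.box, Fintype.mem_piFinset, Finset.mem_range]
    exact fun i => (r i).isLt
  · intro b _; exact Finset.mem_univ _
  · intro r _
    funext i
    exact Fin.ext (Nat.mod_eq_of_lt (r i).isLt)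
  · intro b hb
    simp only [AffineAveraging.box, Fintype.mem_piFinset, Finset.mem_range] at hb
    funext i
    exact Nat.mod_eq_of_lt (hb i)
  · intro r _; rfl

/-! ## §2 (S-TRANSP): base∕running-site transposition of a block-summed, evenly weighted lattice sum -/

/-- [folklore] The shift of the running site to the base: `Σ'_{u′} p (u′ − s)·G u′ = Σ'_w p w·G (s + w)`. -/
theorem tsum_shift_base (p : (Fin d → ℤ) → ℝ) (G : (Fin d → ℤ) → ℝ) (s : Fin d → ℤ) :
    ∑' u', p (u' - s) * G u' = ∑' w, p w * G (s + w) := by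
  rw [← (Equiv.addLeft s).tsum_eq (fun u' => p (u' - s) * G u')]
  refine tsum_congr fun w => ?_
  simp only [Equiv.coe_addLeft, add_sub_cancel_left]

/-- [folklore] **(S-TRANSP)**: for `0 < N`, a two-point function `Φ` JOINTLY `N`-block-periodic (`Φ (u + N•t) (v + N•t) = Φ u v`), an EVEN weight `p`, and per-base absolute
summability of both readings, the block-summed weighted lattice sum is symmetric under exchanging the roles of base and running site:
`Σ_r Σ'_{u′} p (u′ − resSite r)·Φ u′ (resSite r) = Σ_r Σ'_{u′} p (u′ − resSite r)·Φ (resSite r) u′`.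
Proof: shift `u′ = s + w`, swap the finite base sum with the `w`-sum, `MomentTransferPeriodicSum.sum_resSite_sub_eq` at `m b := Φ (b + w) b` (periodic by joint periodicity),
`w ↦ −w`, evenness of `p`. -/
theorem sum_resSite_tsum_transpose (hN : 0 < N) (Φ : (Fin d → ℤ) → (Fin d → ℤ) → ℝ) (p : (Fin d → ℤ) → ℝ)
    (hΦ : ∀ u v t : Fin d → ℤ, Φ (u + (N : ℤ) • t) (v + (N : ℤ) • t) = Φ u v) (hp : ∀ z, p (-z) = p z)
    (hS₁ : ∀ r : Fin d → Fin N, Summable fun w => p w * Φ (resSite r + w) (resSite r))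
    (hS₂ : ∀ r : Fin d → Fin N, Summable fun w => p w * Φ (resSite r) (resSite r + w)) :
    (∑ r : Fin d → Fin N, ∑' u', p (u' - resSite r) * Φ u' (resSite r)) =
      ∑ r : Fin d → Fin N, ∑' u', p (u' - resSite r) * Φ (resSite r) u' := by
  -- both sides in running-displacement form
  have hL : ∀ r : Fin d → Fin N, (∑' u', p (u' - resSite r) * Φ u' (resSite r)) = ∑' w, p w * Φ (resSite r + w) (resSite r) :=
    fun r => tsum_shift_base p (fun u' => Φ u' (resSite r)) (resSite r)
  have hR : ∀ r : Fin d → Fin N, (∑' u', p (u' - resSite r) * Φ (resSite r) u') = ∑' w, p w * Φ (resSite r) (resSite r + w) :=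
    fun r => tsum_shift_base p (fun u' => Φ (resSite r) u') (resSite r)
  simp_rw [hL, hR]
  rw [← Summable.tsum_finsetSum (fun r _ => hS₁ r), ← Summable.tsum_finsetSum (fun r _ => hS₂ r)]
  -- for each displacement: the base sum is shift-invariant (joint periodicity), then `w ↦ −w`
  have hper : ∀ w : Fin d → ℤ, ∑ r : Fin d → Fin N, Φ (resSite r + w) (resSite r) = ∑ r : Fin d → Fin N, Φ (resSite r) (resSite r - w) := by
    intro w
    have hm : ∀ b z : Fin d → ℤ, Φ (b + (N : ℤ) • z + w) (b + (N : ℤ) • z) = Φ (b + w) b := by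
      intro b z
      rw [show b + (N : ℤ) • z + w = (b + w) + (N : ℤ) • z by abel]
      exact hΦ (b + w) b z
    have h := sum_resSite_sub_eq hN (m := fun b => Φ (b + w) b) hm w
    -- `h : Σ_r Φ (resSite r − w + w) (resSite r − w) = Σ_r Φ (resSite r + w) (resSite r)`
    rw [← h]
    refine Finset.sum_congr rfl fun r _ => ?_
    show Φ (resSite r - w + w) (resSite r - w) = Φ (resSite r) (resSite r - w)
    rw [sub_add_cancel]
  calc (∑' w, ∑ r : Fin d → Fin N, p w * Φ (resSite r + w) (resSite r))
      = ∑' w, p w * ∑ r : Fin d → Fin N, Φ (resSite r + w) (resSite r) := by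
        refine tsum_congr fun w => ?_; rw [Finset.mul_sum]
    _ = ∑' w, p w * ∑ r : Fin d → Fin N, Φ (resSite r) (resSite r - w) := by
        refine tsum_congr fun w => ?_; rw [hper w]
    _ = ∑' w, p (-w) * ∑ r : Fin d → Fin N, Φ (resSite r) (resSite r - -w) :=
        ((Equiv.neg (Fin d → ℤ)).tsum_eq (fun w => p w * ∑ r : Fin d → Fin N, Φ (resSite r) (resSite r - w))).symm
    _ = ∑' w, ∑ r : Fin d → Fin N, p w * Φ (resSite r) (resSite r + w) := by
        refine tsum_congr fun w => ?_
        simp only [hp, sub_neg_eq_add, Finset.mul_sum]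

end Summit.QuantumFields.BalabanUV.Beta.D1BFx.BlockSumTranspose

end
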